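/-
Copyright: the b2b-balaban cell (near-miss cell 7), T⁴-continuum fan-out; row NE7b ROUND-2 swarm, seat
t4-ne7b-formalise-leaf-05 gen 2 (row S6g′(c) of `t4/b2b-balaban-t4-ne7b-p1/LEAVES-NE7b.md`, owner's ruling R-OWNER-22-12 (2)).
Released under the licence of the surrounding project.
-/
import Summits.QuantumFields.BalabanUV.T4Continuum.Support.HistorySiblingMass

/-!
# Sibling symmetry, part 3: the NON-HOST MASSES ARE PAID BY DECAY; assembly with `total_cost_le` (row S6g′(c)∕(d))

Summits-side support leaf of the T⁴-continuum cell (rung (B)+1 on a FINITE torus only; NOT infinite volume, NOT the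
mass gap, NOT the Clay statement; NOT a proof of the spine estimate NE7b).  Row NE7b, route «COUNT»; row S6g′, the
tree-free arithmetic between part 2's per-join count (`HistorySiblingOrbits.joinCount_mul_prod_factorial_le_pow_mul`:
per join `log #physical ≤ (r−1)·log(c·S_J) + Σ_{i ≠ host}(log M_i + a_i·log Λ + log W_i) − Σ_g log k_g!`) and the
class-linear budget.  [folklore] real arithmetic and finite sums over ABSTRACT finite index sets; nothing is quoted
from print, nothing printed is asserted, no `[cite:]` tag, no `Prop` fact of Bałaban's.

WHY.  Summed over the joins of a tagged genealogy (the internal counts `W_i` telescoping), the log-count has THREE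
parts: (1) `Σ_t Σ_{groups g at step t} (k_g·log(c·S) − log k_g!)` with `S ≤ C·Q_t` — VERBATIM the left side of
`HistorySiblingMass.total_cost_le` after the constant `log(c·C)` is split off (`Σ_g k_g ≤ n_t` pays it linearly);
(2) `log Λ · Σ_{non-host parts} a_p ≤ log Λ · partnerAges` (into the placement rate); (3) the non-host parts' OWN zone
masses `Σ_p log M_{t_p}(p)` with `M_t(p) ≤ C₀·q_p + c₀`, `q_p` the DECAYED weighted formation count of the part at
the step it joins (`ZoneDrivers.qZ`).  Part (3) is class-linear because the non-host parts containing a given formation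
event occur at PAIRWISE DISTINCT steps (a part that has joined an older host is no longer a part; the merged component
joins later hosts at strictly later steps), so each event's weight is collected along a geometric series:
**`Σ_p q_p ≤ (Σ_w wt w)∕(1 − σ²)`** (`nested_decay_le`), and `log(C₀·q + c₀) ≤ log(C₀ + c₀) + q`.

WHAT.  §1 `sum_pow_le_inv_of_injOn` (a sum of powers `x^{e s}` over distinct exponents is `≤ 1∕(1−x)`).  §2
**`nested_decay_le`**.  §3 `log_affine_le`, `sum_log_affine_le`.  §4 **`log_count_le`**: the three parts assembled with
`total_cost_le` into ONE explicit linear combination of `Σ_t n_t`, `Σ k·r`, `#parts`, `Σ_w wt w`, `Σ_p a_p` (symbolic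
constants) — the binder maps these to `F_w`, `partnerAges`, `#merges` of the member.

HONEST SCOPE.  Arithmetic only; which finite sets are the «parts», «groups», «events» of a tagged genealogy is the
binding of rows (a)(b)(c) and is NOT here.  NE7b NOT proved.  HONEST DEPENDENCY (cell): continuum YM on T⁴ ⇐ BetaPertH
∧ nine spine estimates (0/9 proved); BetaPertH ⇐ (D1) ∧ (D4) ∧ CAP+tail.  This file changes none of it.
-/

open Finset
open Summit.QuantumFields.BalabanUV.T4Continuum.Crowding
open Summit.QuantumFields.BalabanUV.T4Continuum.HistorySiblingMass

namespace Summit.QuantumFields.BalabanUV.T4Continuum.HistorySiblingDecay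

noncomputable section

/-! ## §1 Powers over distinct exponents -/

/-- **A SUM OF POWERS OVER DISTINCT EXPONENTS IS AT MOST THE GEOMETRIC SERIES**: for `0 ≤ x < 1` and `e` injective on `S`,
`Σ_{s ∈ S} x^{e s} ≤ 1∕(1 − x)`. [folklore] -/
theorem sum_pow_le_inv_of_injOn {α : Type*} [DecidableEq α] (S : Finset α) (e : α → ℕ) (he : Set.InjOn e S) {x : ℝ}
    (h0 : 0 ≤ x) (h1 : x < 1) : ∑ s ∈ S, x ^ e s ≤ 1 / (1 - x) := by
  classical
  rw [← sum_image (f := fun d => x ^ d) fun a ha b hb hab => he ha hb hab]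
  set D := (S.image e).sup id + 1 with hD
  calc ∑ d ∈ S.image e, x ^ d ≤ ∑ d ∈ range D, x ^ d := by
        refine sum_le_sum_of_subset_of_nonneg (fun d hd => mem_range.2 ?_) fun _ _ _ => pow_nonneg h0 _
        have : d ≤ (S.image e).sup id := le_sup (f := id) hd
        omega
    _ ≤ 1 / (1 - x) := geom_sum_le_inv h0 h1 D

/-! ## §2 Nested decay: each event's weight is collected along a geometric series -/

/-- **NESTED DECAY.**  Parts `p ∈ P` with steps `tp p` and formation sets `form p ⊆ E` (weights `wt ≥ 0`, steps `st`);
if the parts containing a given event have PAIRWISE DISTINCT steps, all `≥` the event's step, then the decayed masses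
sum class-linearly: `Σ_{p ∈ P} Σ_{w ∈ form p} wt w·σ^{2(tp p − st w)} ≤ (Σ_{w ∈ E} wt w)∕(1 − σ²)`. [folklore] -/
theorem nested_decay_le {π ω : Type*} [DecidableEq π] [DecidableEq ω] (P : Finset π) (tp : π → ℕ)
    (form : π → Finset ω) (E : Finset ω) (hform : ∀ p ∈ P, form p ⊆ E) (wt : ω → ℝ) (hwt : ∀ w ∈ E, 0 ≤ wt w)
    (st : ω → ℕ) (hst : ∀ p ∈ P, ∀ w ∈ form p, st w ≤ tp p)
    (hdist : ∀ w ∈ E, Set.InjOn tp (P.filter fun p => w ∈ form p : Set π)) {σ : ℝ} (h0 : 0 ≤ σ) (h1 : σ < 1) :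
    ∑ p ∈ P, ∑ w ∈ form p, wt w * σ ^ (2 * (tp p - st w)) ≤ (∑ w ∈ E, wt w) / (1 - σ ^ 2) := by
  have hs0 : 0 ≤ σ ^ 2 := sq_nonneg σ
  have hs1 : σ ^ 2 < 1 := by nlinarith
  -- extend the inner sums to `E` with an indicator and swap
  have hswap : ∑ p ∈ P, ∑ w ∈ form p, wt w * σ ^ (2 * (tp p - st w)) =
      ∑ w ∈ E, wt w * ∑ p ∈ P.filter (fun p => w ∈ form p), (σ ^ 2) ^ (tp p - st w) := by
    have h1' : ∀ p ∈ P, ∑ w ∈ form p, wt w * σ ^ (2 * (tp p - st w)) =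
        ∑ w ∈ E, if w ∈ form p then wt w * (σ ^ 2) ^ (tp p - st w) else 0 := by
      intro p hp
      rw [← sum_filter, (filter_mem_eq_inter).trans ((inter_eq_right).2 (hform p hp))]
      exact sum_congr rfl fun w _ => by rw [pow_mul]
    rw [sum_congr rfl h1', sum_comm]
    refine sum_congr rfl fun w _ => ?_
    rw [mul_sum, sum_filter]
  rw [hswap, sum_div]
  refine sum_le_sum fun w hw => ?_
  rw [div_eq_mul_one_div]
  refine mul_le_mul_of_nonneg_left ?_ (hwt w hw)
  -- distinct exponents `tp p − st w` on the parts containing `w`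
  refine sum_pow_le_inv_of_injOn _ (fun p => tp p - st w) ?_ hs0 hs1
  intro p hp p' hp' heq
  have hp1 := Finset.mem_coe.1 hp
  have hp1' := Finset.mem_coe.1 hp'
  rw [mem_filter] at hp1 hp1'
  have h₁ := hst p hp1.1 w hp1.2
  have h₂ := hst p' hp1'.1 w hp1'.2
  refine hdist w hw hp hp' ?_
  simp only at heq
  omega

/-! ## §3 The affine cardinality law under the logarithm -/

/-- `log(C₀·q + c₀) ≤ log(C₀ + c₀) + q` for `q ≥ 0`, `C₀ ≥ 0`, `c₀ ≥ 1`. [folklore] -/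
theorem log_affine_le {C₀ c₀ q : ℝ} (hC : 0 ≤ C₀) (hc : 1 ≤ c₀) (hq : 0 ≤ q) :
    Real.log (C₀ * q + c₀) ≤ Real.log (C₀ + c₀) + q := by
  have h1 : C₀ * q + c₀ ≤ (C₀ + c₀) * (1 + q) := by nlinarith
  have hpos : 0 < C₀ * q + c₀ := by nlinarith
  calc Real.log (C₀ * q + c₀) ≤ Real.log ((C₀ + c₀) * (1 + q)) := Real.log_le_log hpos h1
    _ = Real.log (C₀ + c₀) + Real.log (1 + q) := Real.log_mul (by linarith) (by linarith)
    _ ≤ Real.log (C₀ + c₀) + q := by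
        have := Real.log_le_sub_one_of_pos (show 0 < 1 + q by linarith)
        linarith

/-- summed over the non-host parts: `Σ_p log(C₀·q_p + c₀) ≤ #P·log(C₀ + c₀) + Σ_p q_p`. [folklore] -/
theorem sum_log_affine_le {π : Type*} (P : Finset π) (q : π → ℝ) (hq : ∀ p ∈ P, 0 ≤ q p) {C₀ c₀ : ℝ} (hC : 0 ≤ C₀)
    (hc : 1 ≤ c₀) :
    ∑ p ∈ P, Real.log (C₀ * q p + c₀) ≤ (P.card : ℝ) * Real.log (C₀ + c₀) + ∑ p ∈ P, q p := by
  calc ∑ p ∈ P, Real.log (C₀ * q p + c₀) ≤ ∑ p ∈ P, (Real.log (C₀ + c₀) + q p) :=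
        sum_le_sum fun p hp => log_affine_le hC hc (hq p hp)
    _ = (P.card : ℝ) * Real.log (C₀ + c₀) + ∑ p ∈ P, q p := by rw [sum_add_distrib, sum_const, nsmul_eq_mul]

/-! ## §4 Assembly with `HistorySiblingMass.total_cost_le` -/

/-- **THE LOG-COUNT OF ALL JOINS, ASSEMBLED.**  Per-step data as in `HistorySiblingMass.total_cost_le` (steps `t ≤ T`,
weighted counts `n t`, sibling groups `Gs t` of sizes `k ≥ 1` with `Σ_g k ≤ n t`, ranks `r`, rare-group sums `≤ S`),
a per-merger constant `1 ≤ cC` (touch constant × the comparison `S_J ≤ C·Q_t`), non-host parts `P` with decayed masses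
`q ≥ 0`, cardinality constants `C₀ ≥ 0`, `c₀ ≥ 1`, ages `a`, placement rate `Λ`.  If the log-count is bounded by
the three parts of the module docstring, then
`logN ≤ (1∕(1−σ²) + S + log cC)·Σ_t n_t + c·Σ_t Σ_g k·r + #P·log(C₀ + c₀) + Σ_p q_p + log Λ·Σ_p a_p`. [folklore] -/
theorem log_count_le {β π : Type*} (n : ℕ → ℕ) {σ : ℝ} (h0 : 0 ≤ σ) (h1 : σ < 1) (T : ℕ) (Gs : ℕ → Finset β)
    (k : ℕ → β → ℕ) (r : ℕ → β → ℝ) (c : ℝ) {S : ℝ} (hS : 0 ≤ S) (hk : ∀ t, ∀ g ∈ Gs t, 1 ≤ k t g)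
    (hn : ∀ t, (∑ g ∈ Gs t, (k t g : ℝ)) ≤ n t) (hrare : ∀ t, ∑ g ∈ Gs t, Real.exp (-(c * r t g)) ≤ S)
    {cC : ℝ} (hcC : 1 ≤ cC) (P : Finset π) (q : π → ℝ) (hq : ∀ p ∈ P, 0 ≤ q p) {C₀ c₀ : ℝ} (hC : 0 ≤ C₀)
    (hc : 1 ≤ c₀) (a : π → ℕ) (Λ : ℝ) {logN : ℝ}
    (hcount : logN ≤
      ∑ t ∈ range (T + 1), ∑ g ∈ Gs t, ((k t g : ℝ) * Real.log (cC * Q n σ t) - Real.log (Nat.factorial (k t g) : ℝ)) +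
        ∑ p ∈ P, (Real.log (C₀ * q p + c₀) + (a p : ℝ) * Real.log Λ)) :
    logN ≤ (1 / (1 - σ ^ 2) + S + Real.log cC) * ∑ t ∈ range (T + 1), (n t : ℝ) +
      c * ∑ t ∈ range (T + 1), ∑ g ∈ Gs t, (k t g : ℝ) * r t g +
      ((P.card : ℝ) * Real.log (C₀ + c₀) + ∑ p ∈ P, q p + Real.log Λ * ∑ p ∈ P, (a p : ℝ)) := by
  have hlogc : 0 ≤ Real.log cC := Real.log_nonneg hcC
  -- split off the constant `log cC` where a group exists (`Q_t ≥ n_t ≥ 1` there)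
  have hsplit : ∀ t ∈ range (T + 1),
      ∑ g ∈ Gs t, ((k t g : ℝ) * Real.log (cC * Q n σ t) - Real.log (Nat.factorial (k t g) : ℝ)) ≤
        ∑ g ∈ Gs t, ((k t g : ℝ) * Real.log (Q n σ t) - Real.log (Nat.factorial (k t g) : ℝ)) +
          Real.log cC * n t := by
    intro t _
    by_cases he : Gs t = ∅
    · simp only [he, sum_empty, zero_add]
      exact mul_nonneg hlogc (Nat.cast_nonneg _)
    · obtain ⟨g₀, hg₀⟩ := nonempty_iff_ne_empty.2 he
      have hn0 : (1 : ℝ) ≤ n t := by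
        have h1' : (1 : ℝ) ≤ k t g₀ := by exact_mod_cast hk t g₀ hg₀
        exact h1'.trans ((single_le_sum (fun g _ => (Nat.cast_nonneg (k t g) : (0 : ℝ) ≤ k t g)) hg₀).trans (hn t))
      have hQ : 0 < Q n σ t := lt_of_lt_of_le (by linarith) (self_le_Q n h0 t)
      have hlog : Real.log (cC * Q n σ t) = Real.log cC + Real.log (Q n σ t) :=
        Real.log_mul (by linarith) hQ.ne'
      rw [hlog]
      have : ∑ g ∈ Gs t, ((k t g : ℝ) * (Real.log cC + Real.log (Q n σ t)) - Real.log (Nat.factorial (k t g) : ℝ)) =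
          ∑ g ∈ Gs t, ((k t g : ℝ) * Real.log (Q n σ t) - Real.log (Nat.factorial (k t g) : ℝ)) +
            Real.log cC * ∑ g ∈ Gs t, (k t g : ℝ) := by
        rw [mul_sum, ← sum_add_distrib]
        exact sum_congr rfl fun g _ => by ring
      rw [this]
      have := mul_le_mul_of_nonneg_left (hn t) hlogc
      linarith
  have h1' := sum_le_sum hsplit
  rw [sum_add_distrib, ← mul_sum] at h1'
  have hmain := total_cost_le n h0 h1 T Gs k r c hS hk hn hrare
  have hP := sum_log_affine_le P q hq hC hc
  have hparts : ∑ p ∈ P, (Real.log (C₀ * q p + c₀) + (a p : ℝ) * Real.log Λ) =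
      ∑ p ∈ P, Real.log (C₀ * q p + c₀) + Real.log Λ * ∑ p ∈ P, (a p : ℝ) := by
    rw [sum_add_distrib, mul_sum]
    exact congrArg₂ _ rfl (sum_congr rfl fun p _ => by ring)
  rw [hparts] at hcount
  nlinarith [h1', hmain, hP, hcount]

/-- **WITH NESTED DECAY PLUGGED IN**: if the parts' decayed masses are the `qZ`-type sums of `nested_decay_le`, the term
`Σ_p q_p` above is at most `(Σ_w wt w)∕(1 − σ_m²)`. [folklore] -/
theorem sum_q_le_of_nested {π ω : Type*} [DecidableEq π] [DecidableEq ω] (P : Finset π) (tp : π → ℕ)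
    (form : π → Finset ω) (E : Finset ω) (hform : ∀ p ∈ P, form p ⊆ E) (wt : ω → ℝ) (hwt : ∀ w ∈ E, 0 ≤ wt w)
    (st : ω → ℕ) (hst : ∀ p ∈ P, ∀ w ∈ form p, st w ≤ tp p)
    (hdist : ∀ w ∈ E, Set.InjOn tp (P.filter fun p => w ∈ form p : Set π)) {σm : ℝ} (h0 : 0 ≤ σm) (h1 : σm < 1)
    (q : π → ℝ) (hq : ∀ p ∈ P, q p ≤ ∑ w ∈ form p, wt w * σm ^ (2 * (tp p - st w))) :
    ∑ p ∈ P, q p ≤ (∑ w ∈ E, wt w) / (1 - σm ^ 2) :=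
  (sum_le_sum hq).trans (nested_decay_le P tp form E hform wt hwt st hst hdist h0 h1)

/-! ## §5 Sanity -/

namespace Sanity

/-- two nested parts containing the same unit-weight event at steps `1` and `2`: decayed masses `σ² + σ⁴ ≤ 1∕(1−σ²)` -/
example {σ : ℝ} (h0 : 0 ≤ σ) (h1 : σ < 1) : σ ^ 2 + σ ^ 4 ≤ 1 / (1 - σ ^ 2) := by
  have hs1 : σ ^ 2 < 1 := by nlinarith
  rw [le_div_iff₀ (by linarith)]
  nlinarith [sq_nonneg σ, pow_nonneg h0 4, pow_nonneg h0 6, mul_nonneg (pow_nonneg h0 4) (sq_nonneg σ)]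

end Sanity

end

end Summit.QuantumFields.BalabanUV.T4Continuum.HistorySiblingDecay
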